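import Mathlib
import HarnessLib
import Summits.NavierStokesRegularity.NavierStokesRegularity.Theorems.CompletionRelayChainPhaseIChecker

/-!
# Route `CompletionRelayChain` — crux `RelayFrontStep` (stmt-NavierStokesRegularity-24850), K-side of `stub_phaseI`,
  work package K5-a: SOUNDNESS OF THE CHECKER'S ARITHMETIC — the Taylor-model algebra `tmOps` is an enclosure algebra
  at every box point `θ` (`tmOps_sound`), the upper square root `sqrtUp`, and the real RATES `Λ_k = 2^{5k/2}` inside the
  rational coefficient intervals of `coefsQ` (`√2` bounds)

MODEL-lattice bookkeeping (rung TL-M3-R64); nothing here is a statement about the Navier–Stokes equations.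
-/

noncomputable section

set_option linter.dupNamespace false

namespace Summit.NavierStokesRegularity.NavierStokesRegularity.Cruxes.RelayFrontStep.PhaseI

open Checker

/-! ### The Taylor-model algebra is sound at every box point -/

/-- **`tmOps` is an enclosure algebra** for the containment relation `p ∋_θ x` at any `θ ∈ [−1,1]^7`. [this file] -/
theorem tmOps_sound {θ : Fin 7 → ℝ} (hθ : TM.InBox θ) : EncSound tmOps (fun p x => p.Contains θ x) where
  zero := by
    show (TM.const 0 0 : TM 7).Contains θ 0
    exact TM.contains_const (by simp)
  add := fun _ _ _ _ hx hy => TM.contains_add hx hy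
  mul := fun _ _ _ _ hx hy => TM.contains_mul hθ hx hy
  sq := fun _ _ hx => TM.contains_sq hθ hx
  sclI := fun _ _ _ _ _ hx hlo hhi => TM.contains_sclI hθ hx hlo hhi
  divNat := fun _ _ _ hn hx => TM.contains_divNat hn hx
  post := fun _ _ hx => TM.contains_round P hθ hx

/-! ### The upper square root -/

/-- `√x ≤ sqrtUp x` for `0 ≤ x`. [this file] -/
theorem sqrt_le_sqrtUp {x : ℚ} (hx : 0 ≤ x) : Real.sqrt (x : ℝ) ≤ (sqrtUp x : ℝ) := by
  unfold sqrtUp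
  set N : ℤ := ⌈x * 4 ^ 60⌉ with hN
  set n : ℕ := N.toNat with hn
  set s : ℕ := Nat.sqrt n with hs
  have hN0 : 0 ≤ N := by
    rw [hN]; exact Int.ceil_nonneg (by positivity)
  have hNn : (N : ℚ) = (n : ℚ) := by
    rw [hn]; exact_mod_cast (Int.toNat_of_nonneg hN0).symm
  have h1 : x * 4 ^ 60 ≤ (n : ℚ) := by rw [← hNn, hN]; exact Int.le_ceil _
  have h2 : n < (s + 1) * (s + 1) := by
    have := Nat.lt_succ_sqrt n
    simpa [hs, Nat.succ_eq_add_one] using this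
  have h3 : (x : ℝ) * 4 ^ 60 ≤ ((s : ℝ) + 1) * ((s : ℝ) + 1) := by
    have h2' : (n : ℝ) ≤ ((s : ℝ) + 1) * ((s : ℝ) + 1) := by exact_mod_cast h2.le
    have h1' : (x : ℝ) * 4 ^ 60 ≤ (n : ℝ) := by exact_mod_cast h1
    exact h1'.trans h2'
  have hx' : (0 : ℝ) ≤ x := by exact_mod_cast hx
  have key : (x : ℝ) ≤ ((((s + 1 : ℕ) : ℚ) / 2 ^ 60 : ℚ) : ℝ) ^ 2 := by
    push_cast
    rw [div_pow]
    rw [le_div_iff₀ (by positivity)]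
    calc (x : ℝ) * (2 ^ 60) ^ 2 = (x : ℝ) * 4 ^ 60 := by norm_num
      _ ≤ ((s : ℝ) + 1) * ((s : ℝ) + 1) := h3
      _ = ((s : ℝ) + 1) ^ 2 := by ring
  calc Real.sqrt (x : ℝ) ≤ Real.sqrt (((((s + 1 : ℕ) : ℚ) / 2 ^ 60 : ℚ) : ℝ) ^ 2) := Real.sqrt_le_sqrt key
    _ = ((((s + 1 : ℕ) : ℚ) / 2 ^ 60 : ℚ) : ℝ) := Real.sqrt_sq (by positivity)

/-- `0 < sqrtUp x`. [this file] -/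
theorem sqrtUp_pos (x : ℚ) : 0 < sqrtUp x := by
  unfold sqrtUp; positivity

/-! ### The rates `Λ_k` inside the coefficient intervals -/

/-- `√2 ≥ 1.4142135623730950488`. [this file] -/
theorem sqrt_two_ge : ((14142135623730950488 : ℚ) / 10 ^ 19 : ℝ) ≤ Real.sqrt 2 := by
  rw [Real.le_sqrt (by norm_num) (by norm_num)]
  norm_num

/-- `√2 ≤ 1.4142135623730950489`. [this file] -/
theorem sqrt_two_le : Real.sqrt 2 ≤ ((14142135623730950489 : ℚ) / 10 ^ 19 : ℝ) := by
  have h : (2 : ℝ) ≤ (((14142135623730950489 : ℚ) / 10 ^ 19 : ℝ)) ^ 2 := by norm_num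
  calc Real.sqrt 2 ≤ Real.sqrt ((((14142135623730950489 : ℚ) / 10 ^ 19 : ℝ)) ^ 2) := Real.sqrt_le_sqrt h
    _ = _ := Real.sqrt_sq (by norm_num)

/-- `Λ_k = 2^n` when `5k/2 = n`. [this file] -/
theorem lam_eq_zpow {k n : ℤ} (hk : (5 : ℝ) * (k : ℝ) / 2 = (n : ℝ)) : lam k = (2 : ℝ) ^ n := by
  unfold lam
  rw [hk, show (1 + 1 : ℝ) = 2 by norm_num, Real.rpow_intCast]

/-- `Λ_k = 2^n·√2` when `5k/2 = n + 1/2`. [this file] -/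
theorem lam_eq_zpow_mul_sqrt {k n : ℤ} (hk : (5 : ℝ) * (k : ℝ) / 2 = (n : ℝ) + 1 / 2) :
    lam k = (2 : ℝ) ^ n * Real.sqrt 2 := by
  unfold lam
  rw [hk, show (1 + 1 : ℝ) = 2 by norm_num, Real.rpow_add (by norm_num), Real.rpow_intCast,
    Real.sqrt_eq_rpow]

/-- `Λ₋₄ = 1/1024`. [this file] -/
theorem lam_neg_four : lam (-4) = 1 / 1024 := by
  rw [lam_eq_zpow (n := -10) (by push_cast; norm_num)]; norm_num

/-- `Λ₋₂ = 1/32`. [this file] -/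
theorem lam_neg_two : lam (-2) = 1 / 32 := by
  rw [lam_eq_zpow (n := -5) (by push_cast; norm_num)]; norm_num

/-- `Λ₀ = 1`. [this file] -/
theorem lam_zero' : lam 0 = 1 := by
  rw [lam_eq_zpow (n := 0) (by push_cast; norm_num)]; norm_num

/-- `Λ₂ = 32`. [this file] -/
theorem lam_two : lam 2 = 32 := by
  rw [lam_eq_zpow (n := 5) (by push_cast; norm_num)]; norm_num

/-- `Λ₋₃ = √2/256`. [this file] -/
theorem lam_neg_three : lam (-3) = Real.sqrt 2 / 256 := by
  rw [lam_eq_zpow_mul_sqrt (n := -8) (by push_cast; norm_num)]; norm_num; ring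

/-- `Λ₋₁ = √2/8`. [this file] -/
theorem lam_neg_one : lam (-1) = Real.sqrt 2 / 8 := by
  rw [lam_eq_zpow_mul_sqrt (n := -3) (by push_cast; norm_num)]; norm_num; ring

/-- `Λ₁ = 4√2`. [this file] -/
theorem lam_one : lam 1 = 4 * Real.sqrt 2 := by
  rw [lam_eq_zpow_mul_sqrt (n := 2) (by push_cast; norm_num)]; norm_num

end Summit.NavierStokesRegularity.NavierStokesRegularity.Cruxes.RelayFrontStep.PhaseI

end
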